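import Summits.QuantumFields.YangMills.Theorems.UnitScaleTiltProp7TowerRkGpkGradRowFlat
import Summits.QuantumFields.YangMills.Theorems.UnitScaleTiltProp7FlatGprimeRSTower
import Summits.QuantumFields.YangMills.Theorems.UnitScaleTiltProp7Flat349Certificate
import HarnessLib

/-!
# Route `UnitScaleTilt`, crux K1 «MinimiserStabilityRegPr» (stmt-QuantumFields-19200), stub `stub_existenceMinimalOrbit` (EX) — N06 print row `hPcol` of the EX display
# (S34ᴸ ✓p715121 ll.218–223), FLAT-CERTIFICATE ROAD «hPcol(1)», FILE 4∕4 «THE MEMBER KNIT, BY DUALITY»: **`hPcol_at_one` — THE DISPLAYED GAUGE-COLUMN ROW «the gauge function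
# `λ = G′ᴾR_SD*A` of a ONE-BOND field `A = δ_bd·E` has ℓ¹-mass `Σ_x ‖λ(x)‖ ≤ p139·‖E‖`» AT THE FLAT MEMBER `U₀ := 1`, FOR EVERY MEMBER `(F, n < K)` OF EVERY BLOCK SIZE `L`, WITH AN
# `L`-ONLY (K-UNIFORM, volume-free) CONSTANT `p139`** — the A6ᶜ-class certificate that the EX namer's (P-ℓ¹) reading of [Balaban1985Variational] p.299 l.6 («`G′RD*` is a bounded
# operator in the norm `|·|₍₁₎`») is inhabited and K-uniform at the trivial background (memo `LOCATE-HPCOL-FLATCERT-px20g7.md`, 19200 evidence #43).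

Cell `ym3-torus`, width seat `ym3-torus-px20` (gen 7).  THEOREMS ONLY (0 `def`, 0 `sorry`); `--supports stmt-QuantumFields-19200 --as helper`, count-neutral.  YM₃ on T³ is a ladder
rung (R3), not d = 4, not infinite volume, not the Clay problem.  THIS DISCHARGES NO DISPLAYED ROW: the display's `hPcol` is at CURVED `U₀ ∈ RegPr` (★★OWNER WORD 14: the NE9 tower
letters live on the MODEL window, which `RegPr` does not imply on T³ — px7 g6 LOCATE V-2 (C), px16 g7 ✓`regPr_not_windowOrbit`); nothing of N06, (139), the stub, the crux or the mass
gap is claimed.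

THE MECHANISM (memo §3) — DUALITY.  Print's `|·|₍₁₎` is the weighted SUPREMUM norm of [Balaban1985BackgroundPropagators] (3.41) p.397; the display's row is the ℓ¹ COLUMN of
`T := G′ᴾ(1)R_S(1)D*₁` on a one-bond source, i.e. the sup-ROW of the TRANSPOSE `T† = D₁R_k(1)G′_k(1)` — and that sup-row is a landed tower letter:
(1) FILE 3 ★★★✓`Prop7FlatGprimeRSTower.siteL2Cast_GprimeP_RS_one` + px20 g6's casts (✓`Prop7Flat349Certificate.DstarL2_one_eq`∕`adjoint_covDerivL2K_id`∕`bondL2Cast_toL2_single`,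
lit ✓`covDivL2K_bondL2Cast`) put `Φλ = G′_k(1)(R_k(1)(D₁†χ_{bd₁}z))` on the NE9 tower carrier, `z = frobEquiv⁻¹E`, `bd₁ = bondCast (bondEquiv bd)`;
(2) `Σ_x‖λ(x)‖ ≤ Σ_{y′}‖(Φλ)(y′)‖` (✓`norm_frobEquiv_le`, reindexing along `siteEquiv` and `siteCast`);
(3) with the fibre-unit test field `w(y′) := ‖(Φλ)(y′)‖⁻¹·(Φλ)(y′)`: `c₀·Σ_{y′}‖(Φλ)(y′)‖ = ⟪w, Φλ⟫ = ⟪D₁(R_k(1)(G′_k(1)w)), χ_{bd₁}z⟫ = c₀·⟪(D₁R_kG′_kw)(bd₁), z⟫` (lit ✓`adjoint_GpOfUk`,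
✓`projR_isSymmetric` for `R_k`, `D₁†` := the Hilbert adjoint);
(4) `w = Σ_v 1_{Π⁻¹v}·w` (lit ✓`exists_block_clm_family`), FILE 2 ★★★✓`Prop7TowerRkGpkGradRowFlat.exists_gradRow_RkGpk_one` per block (`F := 1`) and lit ✓`torusSum_le`:
`‖(D₁R_kG′_kw)(bd₁)‖ ≤ B·K₃(δ)`; (5) `‖z‖ ≤ √2‖E‖` (✓`norm_frobEquiv_symm_le`) ⇒ `p139 := √2·B·K₃(δ)`, `B δ` ∃-quantified BEFORE the height by FILE 2 ⇒ K-UNIFORM.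

WHAT IS PROVED (ns `Summit.QuantumFields.YangMills.Theorems.Prop7FlatPcolCertificate`).
* §1 `norm_unitTest_le_one`, `inner_unitTest_eq_norm` (the fibre-unit test field, pointwise), `sum_blockPieces_eq` (a site field is the sum of its big-block pieces).
* §2 ★★ `siteL2Cast_gaugeColumn_one` (step (1): the route's `G′ᴾ(1)R_S(1)D*₁(toL2(δ_bd E))` IS the tower's `G′_k(1)R_k(1)D₁†χ_{bd₁}(frobEquiv⁻¹E)` across the period cast).
* §3 ★★★ `hPcol_at_one` — S34ᴸ's `hPcol` row VERBATIM at `U₀ := 1` (the `RegPr` antecedent dropped — it is ✓`regPr_one`-trivial), `p139` ∃-quantified after `∀ L, 1 < L`; ★★ `hPcol_at_one_letters` —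
  the same in the display's letter shape `∃ p139 : ℕ → ℝ, (∀ L, 1 < L → 0 ≤ p139 L) ∧ ∀ L, 1 < L → row(p139 L)`.
HONEST SCOPE.  Certificate at the flat member only; bookkeeping over FILEs 2–3, px20 g6's casts and landed lit letters; constants crude.  Rung R3, not Clay; YM gap NOT proved.

References: T. Bałaban, CMP **102** (1985) 277–309 [Balaban1985Variational] (p.299 l.6, (137)–(139) pp.298–299); CMP **99** (1985) 389–434 [Balaban1985BackgroundPropagators]
((3.41)–(3.42) p.397, (3.25) p.394, (3.152) p.426, (3.11) p.392, (3.3)∕(3.8) pp.391–392).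
-/

set_option autoImplicit false

noncomputable section

open scoped InnerProductSpace ComplexConjugate Matrix.Norms.L2Operator BigOperators

namespace Summit.QuantumFields.YangMills.Theorems.Prop7FlatPcolCertificate

open Literature.MathematicalPhysics.QuantumFieldTheory.Balaban1983to89
open Literature.MathematicalPhysics.QuantumFieldTheory.Balaban1983to89.T3ContinuumYM3Torus
open Literature.MathematicalPhysics.QuantumFieldTheory.Balaban1983to89.T3Thm1Carrier (Idx)
open T3SectALandauChart (eta eta_pos)
open B4Sect5Torus (TSite tdist tdist_nonneg)
open B4Sect5Proof (latticeConst latticeConst_nonneg)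
open B4Sect5Torus (torusSum_le)
open B9SectCLatticeCarrier (Bond bpos btgt)
open B9Eq311L2Pairing (WL2)
open B9Eq319QprimeTorus (blockCoord)
open B11Eq103H1Complex (SiteL2K BondL2K covDerivL2K covDivL2K adjoint_covDerivL2K projR_isSymmetric RLatticeK)
open B9Eq310HessianOperator (adTransportW)
open B9Eq315QTower (towerP)
open B9Eq316TowerFlatIsOneStep (towerP_eq_fineP_pow siteCast bondCast bondCast_apply siteL2Cast bondL2Cast equiv_siteL2Cast equiv_bondL2Cast covDivL2K_bondL2Cast)
open B9Eq326OperatorTower (RofUk)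
open B9Eq324DeltaPrimeATower (laplacePrimeAk GpOfUk laplacePrimeAk_one_pos)
open B9Eq326WoodburyLettersTower (adjoint_GpOfUk)
open B9Eq310HessianHermitian (adTransportW_adjoint)
open B9Eq349BlockMultipliers (exists_block_clm_family)
open Summit.QuantumFields.YangMills.Theorems.Prop7SectET3Transport (periodsT3 siteEquiv bondEquiv)
open Summit.QuantumFields.YangMills.Theorems.Prop7SectET3HilbertLetters (W₂ frobEquiv toL2 toL2S toL2S_symm_apply DL2 DstarL2)
open Summit.QuantumFields.YangMills.Theorems.Prop7SectET3GaugeProjector (RS)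
open Summit.QuantumFields.YangMills.Theorems.Prop7SectET3DeltaPiPInv (GprimeP)
open Summit.QuantumFields.YangMills.Theorems.Prop7BlockPoincareKerQprime (periodsT3_eq_towerP)
open Summit.QuantumFields.YangMills.Theorems.Prop7RieszTauFrobNorm (norm_frobEquiv_le norm_frobEquiv_symm_le)
open Summit.QuantumFields.YangMills.Theorems.Prop7HqVOfTraceBound (norm_trace_clm_le)
open Summit.QuantumFields.YangMills.Theorems.Prop7FlatGaugeProjectorTower (adTransportW_one_eq)
open Summit.QuantumFields.YangMills.Theorems.Prop7Flat349Certificate (DstarL2_one_eq adjoint_covDerivL2K_id bondL2Cast_toL2_single)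
open Summit.QuantumFields.YangMills.Theorems.Prop7TowerRkGpkGradRowFlat (exists_gradRow_RkGpk_one)
open Summit.QuantumFields.YangMills.Theorems.Prop7FlatGprimeRSTower (siteL2Cast_GprimeP_RS_one)

/-! ## §1 Pointwise letters: the fibre-unit test field; block pieces -/

/-- The fibre-unit test vector has norm `≤ 1`. [folklore] -/
theorem norm_unitTest_le_one (v : W₂) : ‖((‖v‖ : ℂ)⁻¹) • v‖ ≤ 1 := by
  rw [norm_smul, norm_inv, Complex.norm_real, Real.norm_eq_abs, abs_norm]
  by_cases hv : ‖v‖ = 0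
  · rw [hv]; simp
  · rw [inv_mul_cancel₀ hv]

/-- The fibre-unit test vector pairs with `v` to `‖v‖`. [folklore] -/
theorem inner_unitTest_eq_norm (v : W₂) : ⟪((‖v‖ : ℂ)⁻¹) • v, v⟫_ℂ = (‖v‖ : ℂ) := by
  rw [inner_smul_left, inner_self_eq_norm_sq_to_K, map_inv₀, Complex.conj_ofReal]
  by_cases hv : ‖v‖ = 0
  · rw [hv]; simp
  · have hv' : ((‖v‖ : ℝ) : ℂ) ≠ 0 := by exact_mod_cast hv
    field_simp
    norm_cast

/-- A site field is the sum of its big-block pieces. [folklore] -/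
theorem sum_blockPieces_eq {X Y : Type*} [Fintype X] [Fintype Y] [DecidableEq Y] {c : ℝ} [Fact (0 < c)] (π : X → Y)
    (P : Y → WL2 ℂ (fun _ : X => c) W₂ →L[ℂ] WL2 ℂ (fun _ : X => c) W₂)
    (hP : ∀ (y : Y) (f : WL2 ℂ (fun _ : X => c) W₂) (x : X), WL2.equiv ℂ (fun _ : X => c) W₂ (P y f) x = if π x = y then WL2.equiv ℂ (fun _ : X => c) W₂ f x else 0)
    (f : WL2 ℂ (fun _ : X => c) W₂) : ∑ y, P y f = f := by
  apply (WL2.linearEquiv ℂ ℂ (fun _ : X => c)).injective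
  rw [map_sum]
  funext x
  rw [Finset.sum_apply]
  simp only [WL2.linearEquiv_apply, hP]
  rw [Finset.sum_ite_eq, if_pos (Finset.mem_univ _)]

/-! ## §2 Step (1): the route's flat gauge column IS the tower's, across the period cast -/

variable (F : T3Family) (n K : ℕ) (hnK : n < K) (c₀ : ℝ) [Fact (0 < c₀)] (cB : ℝ) [Fact (0 < cB)]

/-- ★★ **`Φ(G′ᴾ(1)(R_S(1)(D*₁(toL2(δ_bd E))))) = G′_k(1)(R_k(1)(D₁†(χ_{bd₁} z)))`**, `z = frobEquiv⁻¹E`, `bd₁ = bondCast hP (bondEquiv F K bd)`, for every `0 ≤ a`, every tower penalty∕coarse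
weight `a′, c₁ > 0` and every positivity witness — FILE 3 ★★★`siteL2Cast_GprimeP_RS_one` after px20 g6's source∕divergence casts.
[cite: Balaban1985BackgroundPropagators, (3.25) p.394, (3.8) p.392, (3.11) p.392] -/
theorem siteL2Cast_gaugeColumn_one [NeZero F.L] {a : ℝ} (ha : 0 ≤ a) (a' c₁ : ℝ) [Fact (0 < c₁)]
    (hpos' : haveI : ∀ i : Fin 3, NeZero ((fun _ : Fin 3 => (F.P K).sitesPerDir (K - n)) i) := fun _ => inferInstance
      ∀ x : SiteL2K ℂ 3 (towerP F.L (fun _ : Fin 3 => (F.P K).sitesPerDir (K - n)) (K - n - 1 + 1)) c₀ W₂, x ≠ 0 →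
        0 < RCLike.re ⟪x, laplacePrimeAk F.L (fun _ : Fin 3 => (F.P K).sitesPerDir (K - n)) (K - n - 1) frobEquiv (eta F n K)
          (fun _ : Bond 3 (towerP F.L (fun _ : Fin 3 => (F.P K).sitesPerDir (K - n)) (K - n - 1 + 1)) => (1 : (Matrix (Fin 2) (Fin 2) ℂ)ˣ)) a'
          (c₁ := c₁) x⟫_ℂ)
    (bd : PBond (F.P K) 0) (E : Matrix (Fin 2) (Fin 2) ℂ) :
    haveI : ∀ i : Fin 3, NeZero ((fun _ : Fin 3 => (F.P K).sitesPerDir (K - n)) i) := fun _ => inferInstance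
    siteL2Cast ℂ (periodsT3_eq_towerP F n K hnK)
        (GprimeP F n K hnK.le c₀ cB a (1 : GaugeField (F.P K) 0 (Matrix.specialUnitaryGroup (Fin 2) ℂ))
          (RS F n K hnK.le c₀ cB (1 : GaugeField (F.P K) 0 (Matrix.specialUnitaryGroup (Fin 2) ℂ))
            (DstarL2 F n K c₀ (1 : GaugeField (F.P K) 0 (Matrix.specialUnitaryGroup (Fin 2) ℂ)) (toL2 F K c₀ (Pi.single bd E))))) =
      GpOfUk F.L (fun _ : Fin 3 => (F.P K).sitesPerDir (K - n)) (K - n - 1) frobEquiv (eta F n K)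
        (fun _ : Bond 3 (towerP F.L (fun _ : Fin 3 => (F.P K).sitesPerDir (K - n)) (K - n - 1 + 1)) => (1 : (Matrix (Fin 2) (Fin 2) ℂ)ˣ)) a'
        (c₁ := c₁) hpos'
        (RofUk F.L (fun _ : Fin 3 => (F.P K).sitesPerDir (K - n)) (K - n - 1) frobEquiv (eta F n K)
          (fun _ : Bond 3 (towerP F.L (fun _ : Fin 3 => (F.P K).sitesPerDir (K - n)) (K - n - 1 + 1)) => (1 : (Matrix (Fin 2) (Fin 2) ℂ)ˣ)) (c₀ := c₀)
          (LinearMap.adjoint (covDerivL2K ℂ c₀ (((eta F n K : ℝ) : ℂ)⁻¹)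
              (adTransportW frobEquiv (fun _ : Bond 3 (towerP F.L (fun _ : Fin 3 => (F.P K).sitesPerDir (K - n)) (K - n - 1 + 1)) => (1 : (Matrix (Fin 2) (Fin 2) ℂ)ˣ))))
            ((WL2.linearEquiv ℂ ℂ (fun _ : Bond 3 (towerP F.L (fun _ : Fin 3 => (F.P K).sitesPerDir (K - n)) (K - n - 1 + 1)) => c₀)).symm
              (Pi.single (bondCast (periodsT3_eq_towerP F n K hnK) (bondEquiv F K bd)) (frobEquiv.symm E))))) := by
  haveI : ∀ i : Fin 3, NeZero ((fun _ : Fin 3 => (F.P K).sitesPerDir (K - n)) i) := fun _ => inferInstance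
  set hP := periodsT3_eq_towerP F n K hnK with hhP
  rw [siteL2Cast_GprimeP_RS_one F n K hnK c₀ cB ha a' c₁ hpos']
  congr 1
  congr 1
  -- `Φ(D*₁ χ) = D₁†(Ψ χ)` with `Ψχ` the tower one-bond source
  rw [adTransportW_one_eq, adjoint_covDerivL2K_id F n K c₀, ← bondL2Cast_toL2_single F n K hnK c₀ bd E, covDivL2K_bondL2Cast, DstarL2_one_eq]
  rfl

/-! ## §3 ★★★ `hPcol` at the flat member -/

set_option maxHeartbeats 400000 in
-- HEARTBEAT rule (README ∕ RULING №24 (a)): the 30-line member statement (`whnf`) + the tower letters `Dt Gt Rt` (`isDefEq` on `GpOfUk … hpos′`) + the duality chain; passes at the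
-- default 200k (≈ 12 s farm) but not at file-global 100k (measured) — budget made explicit and decl-local (the only budget line of the file; §1–§2 are clean at 100k).
/-- ★★★ **`hPcol` AT THE FLAT MEMBER `U₀ := 1`** — the EX display's row VERBATIM (S34ᴸ ✓p715121 ll.220–223) with `U₀ := 1` and the `RegPr` antecedent dropped: for every block size
`L > 1` there is `p139 ≥ 0` such that for every member `i : Idx L`, every fine bond `bd` and `E ∈ M₂(ℂ)`,
`Σ_x ‖(G′ᴾ(1)R_S(1)D*₁(toL2(δ_bd E)))(x)‖ ≤ p139·‖E‖` — the ℓ¹ column of the flat `G′RD*` on a one-bond source ([Balaban1985Variational] p.299 l.6 in the (P-ℓ¹) reading), `K`-uniform,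
the constant a function of `L` (and the weight letter `c₀ L`) only.  FILE 2 on the tower carrier + §2 + the duality of the module docstring.
[cite: Balaban1985Variational, p.299 l.6; Balaban1985BackgroundPropagators, (3.41)–(3.42) p.397, (3.25) p.394, (3.152) p.426, (3.11) p.392] -/
theorem hPcol_at_one (c₀ cB : ℕ → ℝ) [hc₀ : ∀ L : ℕ, Fact (0 < c₀ L)] [hcB : ∀ L : ℕ, Fact (0 < cB L)] (a : ∀ L : ℕ, Idx L → ℝ) (ha : ∀ (L : ℕ) (i : Idx L), 0 < a L i) :
    ∀ (L : ℕ), 1 < L → ∃ p139 : ℝ, 0 ≤ p139 ∧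
      ∀ (i : Idx L) (bd : PBond (i.1.1.P i.1.2.2) 0) (E : Matrix (Fin 2) (Fin 2) ℂ),
        ∑ x : Site (i.1.1.P i.1.2.2) 0, ‖(toL2S i.1.1 i.1.2.2 (c₀ L)).symm (GprimeP i.1.1 i.1.2.1 i.1.2.2 i.2.2.le (c₀ L) (cB L) (a L i) 1
          (RS i.1.1 i.1.2.1 i.1.2.2 i.2.2.le (c₀ L) (cB L) 1 (DstarL2 i.1.1 i.1.2.1 i.1.2.2 (c₀ L) 1 (toL2 i.1.1 i.1.2.2 (c₀ L) (Pi.single bd E))))) x‖ ≤ p139 * ‖E‖ := by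
  classical
  intro L hL
  by_cases hL3 : 3 ≤ L
  swap
  · -- no member has an even or too small `L`: the statement is vacuous
    refine ⟨0, le_rfl, fun i => ?_⟩
    exfalso
    obtain ⟨⟨F, n, K⟩, hF, -⟩ := i
    have h1 := F.hL.1; have h2 := F.hL.2
    rw [show F.L = L from hF] at h1 h2
    rcases h1 with ⟨k, hk⟩
    omega
  haveI : NeZero L := ⟨by omega⟩
  -- the fibre letters of record: `φ := frobEquiv` (`M_φ = 1`, `M_φ′ = √2`), `τ := trace` (`C_τ = 2`), `a′ := 1`, `ρ_w := (c₀ L)⁻¹`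
  have hτφ : ∀ X Y : Matrix (Fin 2) (Fin 2) ℂ, ⟪frobEquiv.symm X, frobEquiv.symm Y⟫_ℂ = Matrix.traceLinearMap (Fin 2) ℂ ℂ (star X * Y) := fun X Y => by
    rw [Prop7SectET3HilbertLetters.inner_frobEquiv_symm, Matrix.traceLinearMap_apply, Matrix.star_eq_conjTranspose]
  have htr : ∀ X Y : Matrix (Fin 2) (Fin 2) ℂ, Matrix.traceLinearMap (Fin 2) ℂ ℂ (X * Y) = Matrix.traceLinearMap (Fin 2) ℂ ℂ (Y * X) := fun X Y => by
    rw [Matrix.traceLinearMap_apply, Matrix.traceLinearMap_apply, Matrix.trace_mul_comm]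
  have hτ₁ : ∀ X : Matrix (Fin 2) (Fin 2) ℂ, Matrix.traceLinearMap (Fin 2) ℂ ℂ (star X) = conj (Matrix.traceLinearMap (Fin 2) ℂ ℂ X) := fun X => by
    rw [Matrix.traceLinearMap_apply, Matrix.traceLinearMap_apply, Matrix.star_eq_conjTranspose, Matrix.trace_conjTranspose]; rfl
  have hτ : ∀ X : Matrix (Fin 2) (Fin 2) ℂ, ‖Matrix.traceLinearMap (Fin 2) ℂ ℂ X‖ ≤ 2 * ‖X‖ := fun X => by
    have h := norm_trace_clm_le X
    rwa [LinearMap.coe_toContinuousLinearMap'] at h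
  have hφ : ∀ w : W₂, ‖frobEquiv w‖ ≤ 1 * ‖w‖ := fun w => by rw [one_mul]; exact norm_frobEquiv_le w
  have hφ' : ∀ X : Matrix (Fin 2) (Fin 2) ℂ, ‖frobEquiv.symm X‖ ≤ Real.sqrt 2 * ‖X‖ := norm_frobEquiv_symm_le
  have hc₀L : 0 < c₀ L := (hc₀ L).out
  obtain ⟨B, δ, hB, hδ, H⟩ := exists_gradRow_RkGpk_one (d := 3) (by norm_num) L (by omega) hL3 frobEquiv zero_le_one (Real.sqrt_nonneg 2) hφ hφ'
    one_pos (Matrix.traceLinearMap (Fin 2) ℂ ℂ) hτ zero_le_two (le_refl (0 : ℝ)) (inv_nonneg.2 hc₀L.le) hτ₁ htr hτφ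
  refine ⟨Real.sqrt 2 * B * latticeConst 3 δ, by have := latticeConst_nonneg 3 hδ.le; positivity, ?_⟩
  rintro ⟨⟨F, n, K⟩, hF, hnK⟩ bd E
  simp only at hF hnK bd E ⊢
  subst hF
  haveI : NeZero F.L := ⟨by omega⟩
  haveI : ∀ i : Fin 3, NeZero ((fun _ : Fin 3 => (F.P K).sitesPerDir (K - n)) i) := fun _ => inferInstance
  have hKn : K - n - 1 + 1 = K - n := by omega
  have hm : ∀ i : Fin 3, 1 ≤ (fun _ : Fin 3 => (F.P K).sitesPerDir (K - n)) i := fun _ => Nat.one_le_iff_ne_zero.2 (NeZero.ne _)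
  have hηL : eta F n K * (F.L : ℝ) ^ (K - n - 1 + 1) = 1 := by
    rw [hKn, eta, ← mul_pow, inv_mul_cancel₀ (by exact_mod_cast (show F.L ≠ 0 by omega)), one_pow]
  have hη : eta F n K ≠ 0 := (eta_pos F n K).ne'
  have hη1 : |eta F n K| ^ 3 / c₀ F.L ≤ (c₀ F.L)⁻¹ := by
    rw [abs_of_pos (eta_pos F n K), div_eq_mul_inv]
    have : eta F n K ^ 3 ≤ 1 := by
      refine pow_le_one₀ (eta_pos F n K).le ?_
      rw [eta]
      exact pow_le_one₀ (inv_nonneg.2 (by positivity)) (inv_le_one_of_one_le₀ (by exact_mod_cast (show 1 ≤ F.L by omega)))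
    calc eta F n K ^ 3 * (c₀ F.L)⁻¹ ≤ 1 * (c₀ F.L)⁻¹ := mul_le_mul_of_nonneg_right this (inv_nonneg.2 hc₀L.le)
      _ = (c₀ F.L)⁻¹ := one_mul _
  set hP := periodsT3_eq_towerP F n K hnK with hhP
  -- tower abbreviations
  set m : Fin 3 → ℕ := fun _ : Fin 3 => (F.P K).sitesPerDir (K - n) with hmdef
  set U1t : Bond 3 (towerP F.L m (K - n - 1 + 1)) → (Matrix (Fin 2) (Fin 2) ℂ)ˣ := fun _ => 1 with hU1t
  set bd₁ : Bond 3 (towerP F.L m (K - n - 1 + 1)) := bondCast hP (bondEquiv F K bd) with hbd₁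
  set z : W₂ := frobEquiv.symm E with hz
  haveI : Fact (0 < c₀ F.L * ((F.L : ℝ) ^ (K - n - 1 + 1)) ^ 3) := ⟨by positivity⟩
  have hpos' := laplacePrimeAk_one_pos F.L m (K - n - 1) frobEquiv (eta F n K) (1 : ℝ) (c₀ := c₀ F.L) (c₁ := c₀ F.L * ((F.L : ℝ) ^ (K - n - 1 + 1)) ^ 3) hη one_pos
  -- the operators on the tower carrier
  set Dt := covDerivL2K ℂ (c₀ F.L) (((eta F n K : ℝ) : ℂ)⁻¹) (adTransportW frobEquiv U1t) with hDt
  set Gt := GpOfUk F.L m (K - n - 1) frobEquiv (eta F n K) U1t 1 (c₁ := c₀ F.L * ((F.L : ℝ) ^ (K - n - 1 + 1)) ^ 3) hpos' with hGt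
  set Rt := RofUk F.L m (K - n - 1) frobEquiv (eta F n K) U1t (c₀ := c₀ F.L) with hRt
  set χ₁ : BondL2K ℂ 3 (towerP F.L m (K - n - 1 + 1)) (c₀ F.L) W₂ :=
    (WL2.linearEquiv ℂ ℂ (fun _ : Bond 3 (towerP F.L m (K - n - 1 + 1)) => c₀ F.L)).symm (Pi.single bd₁ z) with hχ₁
  -- step (1): the route's column IS `u := Gt (Rt (Dt† χ₁))` across the cast
  set V := GprimeP F n K hnK.le (c₀ F.L) (cB F.L) (a F.L ⟨(F, n, K), rfl, hnK⟩) 1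
    (RS F n K hnK.le (c₀ F.L) (cB F.L) 1 (DstarL2 F n K (c₀ F.L) 1 (toL2 F K (c₀ F.L) (Pi.single bd E)))) with hV
  set u := Gt (Rt (LinearMap.adjoint Dt χ₁)) with hu
  have hΦV : siteL2Cast ℂ hP V = u :=
    siteL2Cast_gaugeColumn_one F n K hnK (c₀ F.L) (cB F.L) (ha _ _).le 1 _ hpos' bd E
  -- step (2): the column sum through the casts
  have hstep2 : ∑ x : Site (F.P K) 0, ‖(toL2S F K (c₀ F.L)).symm V x‖ ≤
      ∑ y' : TSite 3 (towerP F.L m (K - n - 1 + 1)), ‖WL2.equiv ℂ (fun _ : TSite 3 (towerP F.L m (K - n - 1 + 1)) => c₀ F.L) W₂ u y'‖ := by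
    calc ∑ x : Site (F.P K) 0, ‖(toL2S F K (c₀ F.L)).symm V x‖
        ≤ ∑ x : Site (F.P K) 0, ‖WL2.equiv ℂ (fun _ : TSite 3 (periodsT3 F K) => c₀ F.L) W₂ V (siteEquiv F K x)‖ :=
          Finset.sum_le_sum fun x _ => by rw [toL2S_symm_apply]; exact norm_frobEquiv_le _
      _ = ∑ y : TSite 3 (periodsT3 F K), ‖WL2.equiv ℂ (fun _ : TSite 3 (periodsT3 F K) => c₀ F.L) W₂ V y‖ :=
          (siteEquiv F K).sum_comp (fun y => ‖WL2.equiv ℂ (fun _ : TSite 3 (periodsT3 F K) => c₀ F.L) W₂ V y‖)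
      _ = ∑ y' : TSite 3 (towerP F.L m (K - n - 1 + 1)), ‖WL2.equiv ℂ (fun _ : TSite 3 (periodsT3 F K) => c₀ F.L) W₂ V ((siteCast hP).symm y')‖ :=
          ((siteCast hP).symm.sum_comp (fun y => ‖WL2.equiv ℂ (fun _ : TSite 3 (periodsT3 F K) => c₀ F.L) W₂ V y‖)).symm
      _ = _ := by
          refine Finset.sum_congr rfl fun y' _ => ?_
          rw [← hΦV, equiv_siteL2Cast]; rfl
  -- step (3): duality with the fibre-unit test field
  set w : SiteL2K ℂ 3 (towerP F.L m (K - n - 1 + 1)) (c₀ F.L) W₂ :=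
    (WL2.linearEquiv ℂ ℂ (fun _ : TSite 3 (towerP F.L m (K - n - 1 + 1)) => c₀ F.L)).symm
      (fun y' => ((‖WL2.equiv ℂ (fun _ : TSite 3 (towerP F.L m (K - n - 1 + 1)) => c₀ F.L) W₂ u y'‖ : ℂ)⁻¹) •
        WL2.equiv ℂ (fun _ : TSite 3 (towerP F.L m (K - n - 1 + 1)) => c₀ F.L) W₂ u y') with hw
  have hw_apply : ∀ y', WL2.equiv ℂ (fun _ : TSite 3 (towerP F.L m (K - n - 1 + 1)) => c₀ F.L) W₂ w y' =
      ((‖WL2.equiv ℂ (fun _ : TSite 3 (towerP F.L m (K - n - 1 + 1)) => c₀ F.L) W₂ u y'‖ : ℂ)⁻¹) •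
        WL2.equiv ℂ (fun _ : TSite 3 (towerP F.L m (K - n - 1 + 1)) => c₀ F.L) W₂ u y' := fun y' => rfl
  have hw1 : ∀ y', ‖WL2.equiv ℂ (fun _ : TSite 3 (towerP F.L m (K - n - 1 + 1)) => c₀ F.L) W₂ w y'‖ ≤ 1 := fun y' => by
    rw [hw_apply]; exact norm_unitTest_le_one _
  have hinner : ⟪w, u⟫_ℂ = ((c₀ F.L : ℝ) : ℂ) * ∑ y', ((‖WL2.equiv ℂ (fun _ : TSite 3 (towerP F.L m (K - n - 1 + 1)) => c₀ F.L) W₂ u y'‖ : ℝ) : ℂ) := by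
    rw [WL2.inner_def, Finset.mul_sum]
    refine Finset.sum_congr rfl fun y' _ => ?_
    rw [hw_apply, inner_unitTest_eq_norm]
    rfl
  -- the transposed word: `⟪w, Gt (Rt (Dt† χ₁))⟫ = ⟪Dt (Rt (Gt w)), χ₁⟫`
  have hRS : ∀ (b : Bond 3 (towerP F.L m (K - n - 1 + 1))) (v v' : W₂), ⟪adTransportW frobEquiv U1t b v, v'⟫_ℂ = ⟪v, adTransportW frobEquiv (fun b => (U1t b)⁻¹) b v'⟫_ℂ :=
    adTransportW_adjoint frobEquiv (Matrix.traceLinearMap (Fin 2) ℂ ℂ) htr (fun _ => by rw [hU1t, Units.val_one, star_one, inv_one, Units.val_one]) hτφ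
  have hGsym : LinearMap.adjoint Gt = Gt := by
    rw [hGt]; exact adjoint_GpOfUk F.L m (K - n - 1) frobEquiv (c₀ F.L) (eta F n K) U1t _ 1 hRS hpos'
  have hRsym : (Rt).IsSymmetric := by
    rw [hRt]; unfold RofUk; rw [RLatticeK]; exact projR_isSymmetric _ _
  have hdual : ⟪w, u⟫_ℂ = ⟪Dt (Rt (Gt w)), χ₁⟫_ℂ := by
    rw [hu, ← LinearMap.adjoint_inner_left Gt, hGsym, ← hRsym (Gt w), LinearMap.adjoint_inner_right]
  -- the one-bond pairing on the tower carrier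
  have hpair : ⟪Dt (Rt (Gt w)), χ₁⟫_ℂ = ((c₀ F.L : ℝ) : ℂ) * ⟪WL2.equiv ℂ (fun _ : Bond 3 (towerP F.L m (K - n - 1 + 1)) => c₀ F.L) W₂ (Dt (Rt (Gt w))) bd₁, z⟫_ℂ := by
    rw [WL2.inner_def, Finset.sum_eq_single bd₁]
    · rw [hχ₁, WL2.linearEquiv_symm_apply, Equiv.apply_symm_apply, Pi.single_eq_same]
      norm_cast
    · intro b _ hb
      rw [hχ₁, WL2.linearEquiv_symm_apply, Equiv.apply_symm_apply, Pi.single_eq_of_ne hb, inner_zero_right, mul_zero]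
    · intro h; exact absurd (Finset.mem_univ _) h
  -- step (4): the gradient row, block by block
  obtain ⟨PS, hPS⟩ := exists_block_clm_family (𝕜 := ℂ) (w := fun _ : TSite 3 (towerP F.L m (K - n - 1 + 1)) => c₀ F.L) (V := W₂)
    (fun x : TSite 3 (towerP F.L m (K - n - 1 + 1)) => blockCoord (F.L ^ (K - n - 1 + 1)) m (siteCast (towerP_eq_fineP_pow F.L m (K - n - 1 + 1)) x))
  have hwsum : w = ∑ v : TSite 3 m, PS v w := (sum_blockPieces_eq _ PS hPS w).symm
  have hrow : ‖WL2.equiv ℂ (fun _ : Bond 3 (towerP F.L m (K - n - 1 + 1)) => c₀ F.L) W₂ (Dt (Rt (Gt w))) bd₁‖ ≤ B * latticeConst 3 δ := by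
    have hlin : Dt (Rt (Gt w)) = ∑ v : TSite 3 m, Dt (Rt (Gt (PS v w))) := by
      conv_lhs => rw [hwsum]
      rw [map_sum, map_sum, map_sum]
    rw [hlin, show WL2.equiv ℂ (fun _ : Bond 3 (towerP F.L m (K - n - 1 + 1)) => c₀ F.L) W₂ (∑ v : TSite 3 m, Dt (Rt (Gt (PS v w)))) bd₁ =
        ∑ v : TSite 3 m, WL2.equiv ℂ (fun _ : Bond 3 (towerP F.L m (K - n - 1 + 1)) => c₀ F.L) W₂ (Dt (Rt (Gt (PS v w)))) bd₁ from by
      rw [← WL2.linearEquiv_apply (R := ℂ), map_sum, Finset.sum_apply]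
      simp only [WL2.linearEquiv_apply]]
    refine (norm_sum_le _ _).trans ?_
    have hv : ∀ v : TSite 3 m, ‖WL2.equiv ℂ (fun _ : Bond 3 (towerP F.L m (K - n - 1 + 1)) => c₀ F.L) W₂ (Dt (Rt (Gt (PS v w)))) bd₁‖ ≤
        B * Real.exp (-(δ * tdist m (blockCoord (F.L ^ (K - n - 1 + 1)) m (siteCast (towerP_eq_fineP_pow F.L m (K - n - 1 + 1)) (btgt bd₁))) v)) * 1 := by
      intro v
      rw [hDt, hRt, hGt]
      exact H (K - n - 1) (eta F n K) hηL (c₀ F.L) (c₀ F.L * ((F.L : ℝ) ^ (K - n - 1 + 1)) ^ 3) rfl hη1 m hm hpos' v (PS v w) 1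
        (fun x hx => by rw [hPS, if_neg hx]) (fun x => by
          rw [hPS]
          by_cases hx : blockCoord (F.L ^ (K - n - 1 + 1)) m (siteCast (towerP_eq_fineP_pow F.L m (K - n - 1 + 1)) x) = v
          · rw [if_pos hx]; exact hw1 x
          · rw [if_neg hx, norm_zero]; exact zero_le_one) bd₁
    calc ∑ v : TSite 3 m, ‖WL2.equiv ℂ (fun _ : Bond 3 (towerP F.L m (K - n - 1 + 1)) => c₀ F.L) W₂ (Dt (Rt (Gt (PS v w)))) bd₁‖
        ≤ ∑ v : TSite 3 m, B * Real.exp (-(δ * tdist m (blockCoord (F.L ^ (K - n - 1 + 1)) m (siteCast (towerP_eq_fineP_pow F.L m (K - n - 1 + 1)) (btgt bd₁))) v)) * 1 :=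
          Finset.sum_le_sum fun v _ => hv v
      _ = B * ∑ v : TSite 3 m, Real.exp (-(δ * tdist m (blockCoord (F.L ^ (K - n - 1 + 1)) m (siteCast (towerP_eq_fineP_pow F.L m (K - n - 1 + 1)) (btgt bd₁))) v)) := by
          rw [Finset.mul_sum]; exact Finset.sum_congr rfl fun v _ => by ring
      _ ≤ B * latticeConst 3 δ := mul_le_mul_of_nonneg_left (torusSum_le 3 hm hδ _) hB
  -- step (5): assemble
  have hzE : ‖z‖ ≤ Real.sqrt 2 * ‖E‖ := hφ' E
  have hsumC : ((c₀ F.L : ℝ)) * ∑ y', ‖WL2.equiv ℂ (fun _ : TSite 3 (towerP F.L m (K - n - 1 + 1)) => c₀ F.L) W₂ u y'‖ ≤ (c₀ F.L) * (B * latticeConst 3 δ * ‖z‖) := by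
    have h1 : ((c₀ F.L : ℝ)) * ∑ y', ‖WL2.equiv ℂ (fun _ : TSite 3 (towerP F.L m (K - n - 1 + 1)) => c₀ F.L) W₂ u y'‖ = RCLike.re ⟪w, u⟫_ℂ := by
      rw [hinner]
      simp only [RCLike.re_to_complex, Complex.mul_re, Complex.ofReal_re, Complex.ofReal_im, zero_mul, sub_zero]
      rw [← Complex.ofReal_sum, Complex.ofReal_re]
    rw [h1, hdual, hpair]
    refine (RCLike.re_le_norm _).trans ?_
    rw [norm_mul, Complex.norm_real, Real.norm_eq_abs, abs_of_pos hc₀L]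
    refine mul_le_mul_of_nonneg_left ((norm_inner_le_norm _ _).trans (mul_le_mul_of_nonneg_right hrow (norm_nonneg _))) hc₀L.le
  have hsum' : ∑ y', ‖WL2.equiv ℂ (fun _ : TSite 3 (towerP F.L m (K - n - 1 + 1)) => c₀ F.L) W₂ u y'‖ ≤ B * latticeConst 3 δ * ‖z‖ :=
    le_of_mul_le_mul_left hsumC hc₀L
  have hK0 : 0 ≤ latticeConst 3 δ := latticeConst_nonneg 3 hδ.le
  calc ∑ x : Site (F.P K) 0, ‖(toL2S F K (c₀ F.L)).symm V x‖
      ≤ ∑ y', ‖WL2.equiv ℂ (fun _ : TSite 3 (towerP F.L m (K - n - 1 + 1)) => c₀ F.L) W₂ u y'‖ := hstep2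
    _ ≤ B * latticeConst 3 δ * ‖z‖ := hsum'
    _ ≤ B * latticeConst 3 δ * (Real.sqrt 2 * ‖E‖) := mul_le_mul_of_nonneg_left hzE (mul_nonneg hB hK0)
    _ = Real.sqrt 2 * B * latticeConst 3 δ * ‖E‖ := by ring

/-- ★★ **Row `hPcol` on the flat orbit, in the EX display's letter shape (S34ᴸ ll.220–223).**  Skolemising `hPcol_at_one`: there is a function `p139 : ℕ → ℝ` with `0 ≤ p139 L` whenever
`1 < L` (the display's `hp139` sign row), such that for every `1 < L` and every index `i : Idx L` the (P-ℓ¹) gauge-column row of the one-level member holds at the flat background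
`U₀ := 1` — the display's binder `hPcol` restricted to `U₀ = 1`, with its letters `(p139 : ℕ → ℝ)`, `hp139` supplied (the `RegPr` premise is ✓`regPr_one`-trivial on the flat orbit).
[cite: Balaban1985Variational, p.299 l.6; Balaban1985BackgroundPropagators, (3.41)–(3.42) p.397, (3.25) p.394] -/
theorem hPcol_at_one_letters (c₀ cB : ℕ → ℝ) [hc₀ : ∀ L : ℕ, Fact (0 < c₀ L)] [hcB : ∀ L : ℕ, Fact (0 < cB L)] (a : ∀ L : ℕ, Idx L → ℝ)
    (ha : ∀ (L : ℕ) (i : Idx L), 0 < a L i) :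
    ∃ p139 : ℕ → ℝ, (∀ L : ℕ, 1 < L → 0 ≤ p139 L) ∧
      ∀ (L : ℕ), 1 < L → ∀ (i : Idx L) (bd : PBond (i.1.1.P i.1.2.2) 0) (E : Matrix (Fin 2) (Fin 2) ℂ),
        ∑ x : Site (i.1.1.P i.1.2.2) 0, ‖(toL2S i.1.1 i.1.2.2 (c₀ L)).symm (GprimeP i.1.1 i.1.2.1 i.1.2.2 i.2.2.le (c₀ L) (cB L) (a L i) 1
          (RS i.1.1 i.1.2.1 i.1.2.2 i.2.2.le (c₀ L) (cB L) 1 (DstarL2 i.1.1 i.1.2.1 i.1.2.2 (c₀ L) 1 (toL2 i.1.1 i.1.2.2 (c₀ L) (Pi.single bd E))))) x‖ ≤ p139 L * ‖E‖ := by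
  classical
  have h := hPcol_at_one c₀ cB a ha
  refine ⟨fun L => if hL : 1 < L then (h L hL).choose else 0, ?_, ?_⟩
  · intro L hL
    simp only [dif_pos hL]
    exact (h L hL).choose_spec.1
  · intro L hL i bd E
    simp only [dif_pos hL]
    exact (h L hL).choose_spec.2 i bd E

end Summit.QuantumFields.YangMills.Theorems.Prop7FlatPcolCertificate

end
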